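import Mathlib.NumberTheory.ModularForms.EisensteinSeries.Basic
import Mathlib.NumberTheory.ModularForms.CongruenceSubgroups
import Mathlib.NumberTheory.DirichletCharacter.Basic
import Mathlib.Analysis.Normed.Group.Tannery
import HarnessLib

/-!
# Eisenstein series with nebentypus on `Γ₀(N)` in weights `k ≥ 3`: the slash law, the value at
# `i∞`, non-vanishing, and the resulting modular forms on `Γ₁(N)`

For `N ≥ 1`, an integer `k ≥ 3` and a Dirichlet character `χ` modulo `N` we form, from Mathlib's
Eisenstein series `E_{k,a} = ∑_{(c,d) ≡ a, gcd(c,d)=1} (cτ+d)^{-k}` of level `Γ(N)`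
(`eisensteinSeries a k`, `ModularForm.eisensteinSeriesMF`), the character sum

  `E_k^χ(τ) = ∑_{u ∈ (ℤ/Nℤ)ˣ} χ(u)⁻¹ E_{k,(0,u)}(τ)`      (`eisensteinChar N k χ`),

the classical Eisenstein series "of type `(k, χ)` at the cusp `∞`" (Diamond–Shurman §4.2–4.6, the
series `G_k^{𝟙,χ̄}`/`E_k^{ψ,φ}` with `ψ` trivial, up to normalisation; Shimura 1971 §3.5, the
forms of `M_k(Γ₀(N), χ)` attached to the cusps). Everything is proved; there are no named facts:

* `eisensteinSeries_vecMul_gamma0` — for `γ = (a b; c d) ∈ Γ₀(N)`, `(0, u)γ ≡ (0, ud)`, so that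
  `E_{k,(0,u)} ∣_k γ = E_{k,(0,ud)}` (Mathlib `eisensteinSeries_slash_apply`);
* `eisensteinChar_slash_of_mem_gamma0` — **the nebentypus law** `E_k^χ ∣_k γ = χ(d) E_k^χ` for
  `γ ∈ Γ₀(N)` (reindex the units by `u ↦ ud`);
* `tendsto_eisensteinSeries_atImInfty` — **the value of `E_{k,a}` at `i∞`**:
  `E_{k,a}(τ) → [a ≡ (0,1)] + [a ≡ (0,-1)](-1)^{-k}` as `im τ → ∞` (only the terms with `c = 0`,
  i.e. `(c, d) = (0, ±1)`, survive; Tannery's theorem on a vertical strip of width `N`, to which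
  every `τ` is moved by the `N`-periodicity of `E_{k,a}`);
* `tendsto_eisensteinChar_atImInfty` — `E_k^χ(τ) → 1 + χ(-1)(-1)^k`, hence
  `eisensteinChar_ne_zero` — **`E_k^χ ≢ 0` when `χ(-1) = (-1)^k`** (the limit is `2`);
* `eisensteinCharMF` — `E_k^χ` as a `ModularForm (Gamma1 N) k` (invariance from the nebentypus law
  with `d ≡ 1`, holomorphy and boundedness at all cusps from Mathlib's level-`Γ(N)` theory), with
  `eisensteinCharMF_slash_of_mem_gamma0` and `eisensteinCharMF_ne_zero`;
* `eq_zero_of_sum_nebentypus_eq_zero` — **functions of pairwise distinct nebentypus are linearly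
  independent** (`∑_χ f_χ = 0` with `f_χ ∣_k γ = χ(d) f_χ` on `Γ₀(N)` forces every `f_χ = 0`:
  twist by `γ_d ∈ Γ₀(N)` with lower-right entry `d` — `exists_mem_gamma0_apply_one_one_eq` — and
  use orthogonality of the characters of `(ℤ/Nℤ)ˣ`), i.e. the decomposition
  `M_k(Γ₁(N)) = ⊕_χ M_k(Γ₀(N), χ)` at the level of functions.

These are the explicit forms of exact nebentypus needed, for instance, to separate the characters
of `(ℤ/Nℤ)ˣ` inside `M_k(Γ₁(N)) = ⊕_χ M_k(Γ₀(N), χ)`: multiplying the `[SL₂(ℤ) : Γ₀(N)]`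
`ℂ[E₄, E₆]`-independent forms `Δ^{μ-1-i}Δ_N^i` of `ModularFormsGamma0Rank` (`explicitForm_indep`)
by one `E_k^χ ≢ 0` for each even `χ` gives, by `eq_zero_of_sum_nebentypus_eq_zero` and the
identity theorem, `φ(N)/2 · [SL₂(ℤ) : Γ₀(N)] = [SL₂(ℤ) : ±Γ₁(N)]` independent even-weight forms on
`Γ₁(N)` — the rank input of the free-module (Gannon) route to the dimension formula for
`M_k(Γ₁(N))`, as `ModularFormsGamma0Rank` does it for `Γ₀(N)`. Deliberately NOT here:
`q`-expansions of `E_k^χ`, the Eisenstein series at the other cusps, weights `1` and `2`, and the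
dimension of the Eisenstein space.

## References

* F. Diamond, J. Shurman, *A first course in modular forms*, GTM 228, Springer (2005), §4.2
  (Eisenstein series for `Γ(N)` and their values at the cusps), Thm. 4.2.3, §4.3 (decomposition
  of `M_k(Γ₁(N))` by characters), §4.5–4.6 (`E_k^{ψ,φ} ∈ M_k(N, ψφ)`), §5.2 (`Γ₀(N) → (ℤ/Nℤ)ˣ`).
* G. Shimura, *Introduction to the arithmetic theory of automorphic functions*, Publ. Math. Soc.
  Japan 11 (1971), §3.5 (forms of `M_k(Γ₀(N), χ)`), Thm. 2.23 ff. (Eisenstein series).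
-/

noncomputable section

open ModularForm EisensteinSeries UpperHalfPlane CongruenceSubgroup Filter Matrix
  Matrix.SpecialLinearGroup
open scoped MatrixGroups Topology Manifold

namespace Literature.NumberTheory.EllipticCurves.ModularForms

/-! ### The value of `E_{k,a}` at `i∞` -/

section CuspValue

variable {N : ℕ} [NeZero N] {k : ℤ}

/-- The value of the level-`Γ(N)` Eisenstein series `E_{k,a}` (sum over coprime pairs
`(c, d) ≡ a (mod N)`) at the cusp `i∞`: the pairs with `c = 0` are `(0, ±1)`, contributing
`1` if `a ≡ (0, 1)` and `(-1)^{-k}` if `a ≡ (0, -1)` (both if `N ∣ 2`).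
[cite: DiamondShurman2005, §4.2 (Thm. 4.2.3)] -/
def eisCuspValue (a : Fin 2 → ZMod N) (k : ℤ) : ℂ :=
  (if ((↑) : ℤ → ZMod N) ∘ ![0, 1] = a then 1 else 0) +
    (if ((↑) : ℤ → ZMod N) ∘ ![0, -1] = a then (-1 : ℂ) ^ (-k) else 0)

/-- `im τ → ∞` along `atImInfty`. [folklore] -/
theorem tendsto_im_atImInfty : Tendsto UpperHalfPlane.im atImInfty atTop := by
  rw [atImInfty]
  exact tendsto_comap

/-- A summand `(cτ + d)^{-k}` with `c ≠ 0` tends to `0` as `im τ → ∞` (`|cτ + d| ≥ |c| im τ`).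
[folklore] -/
theorem tendsto_eisSummand_atImInfty_of_ne_zero (hk : 0 < k) {v : Fin 2 → ℤ} (hv : v 0 ≠ 0) :
    Tendsto (fun z : ℍ ↦ eisSummand k v z) atImInfty (𝓝 0) := by
  rw [tendsto_zero_iff_norm_tendsto_zero]
  have him : ∀ z : ℍ, z.im ≤ ‖(v 0 : ℂ) * (z : ℂ) + v 1‖ := fun z ↦ by
    refine le_trans ?_ (Complex.abs_im_le_norm _)
    have h1 : (((v 0 : ℂ) * (z : ℂ) + v 1).im) = (v 0 : ℝ) * z.im := by simp
    rw [h1, abs_mul, abs_of_pos z.im_pos]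
    have h2 : (1 : ℝ) ≤ |(v 0 : ℝ)| := by
      rw [← Int.cast_abs]
      exact_mod_cast Int.one_le_abs hv
    nlinarith [z.im_pos]
  have h1 : Tendsto (fun z : ℍ ↦ ‖(v 0 : ℂ) * (z : ℂ) + v 1‖) atImInfty atTop :=
    tendsto_atTop_mono him tendsto_im_atImInfty
  have h2 := (tendsto_zpow_atTop_zero (show -k < 0 by omega)).comp h1
  have h3 : (fun z : ℍ ↦ ‖eisSummand k v z‖) = (fun x : ℝ ↦ x ^ (-k)) ∘
      fun z : ℍ ↦ ‖(v 0 : ℂ) * (z : ℂ) + v 1‖ := by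
    funext z
    simp [eisSummand, norm_zpow]
  rwa [h3]

omit [NeZero N] in
/-- **Tannery on the strip**: along `im τ → ∞` with `|re τ| ≤ N`, `E_{k,a}(τ)` tends to the sum of
its `c = 0` terms (termwise limits; domination by `r(N,1)^{-k}‖(c,d)‖^{-k}`, Mathlib
`summand_bound_of_mem_verticalStrip`). [folklore] -/
theorem tendsto_eisensteinSeries_inf_principal (hk : 3 ≤ k) (a : Fin 2 → ZMod N) :
    Tendsto (eisensteinSeries a k) (atImInfty ⊓ 𝓟 {z : ℍ | |z.re| ≤ N})
      (𝓝 (∑' x : gammaSet N 1 a, if x.1 0 = 0 then ((x.1 1 : ℤ) : ℂ) ^ (-k) else 0)) := by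
  have hk' : (2 : ℝ) < k := by exact_mod_cast (show (2 : ℤ) < k by omega)
  have hS : Summable fun x : Fin 2 → ℤ ↦ r ⟨⟨N, 1⟩, one_pos⟩ ^ (-k) * ‖x‖ ^ (-k) := by
    exact_mod_cast (summable_one_div_norm_rpow hk').mul_left (r ⟨⟨N, 1⟩, one_pos⟩ ^ (-k))
  refine tendsto_tsum_of_dominated_convergence
    (f := fun (z : ℍ) (x : gammaSet N 1 a) ↦ eisSummand k x z)
    (bound := fun x : gammaSet N 1 a ↦ r ⟨⟨N, 1⟩, one_pos⟩ ^ (-k) * ‖(x : Fin 2 → ℤ)‖ ^ (-k))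
    (hS.subtype (gammaSet N 1 a)) (fun x ↦ ?_) ?_
  · by_cases hx : x.1 0 = 0
    · rw [if_pos hx]
      have : (fun z : ℍ ↦ eisSummand k x z) = fun _ ↦ ((x.1 1 : ℤ) : ℂ) ^ (-k) := by
        funext z
        simp [eisSummand, hx]
      rw [this]
      exact tendsto_const_nhds
    · rw [if_neg hx]
      exact (tendsto_eisSummand_atImInfty_of_ne_zero (by omega) hx).mono_left inf_le_left
  · have hmem : {z : ℍ | 1 ≤ z.im} ∩ {z : ℍ | |z.re| ≤ N} ∈ atImInfty ⊓ 𝓟 {z : ℍ | |z.re| ≤ N} :=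
      inter_mem (mem_inf_of_left ((atImInfty_mem _).2 ⟨1, fun _ hz ↦ hz⟩))
        (mem_inf_of_right (mem_principal_self _))
    filter_upwards [hmem] with z hz
    intro x
    have hstrip : z ∈ verticalStrip N 1 := ⟨hz.2, hz.1⟩
    have hb := summand_bound_of_mem_verticalStrip (z := z) (show (0 : ℝ) ≤ k by positivity) x.1
      one_pos hstrip
    simp only [eisSummand, norm_zpow]
    exact_mod_cast hb

omit [NeZero N] in
/-- **The sum of the `c = 0` terms of `E_{k,a}` is `eisCuspValue a k`**: a coprime pair `(0, d)`
has `d = ±1`. [folklore] -/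
theorem tsum_gammaSet_fst_eq_zero (a : Fin 2 → ZMod N) (k : ℤ) :
    (∑' x : gammaSet N 1 a, if x.1 0 = 0 then ((x.1 1 : ℤ) : ℂ) ^ (-k) else 0) =
      eisCuspValue a k := by
  classical
  set G : (Fin 2 → ℤ) → ℂ := fun v ↦ if v 0 = 0 then ((v 1 : ℤ) : ℂ) ^ (-k) else 0 with hG
  have h1 : (∑' x : gammaSet N 1 a, if x.1 0 = 0 then ((x.1 1 : ℤ) : ℂ) ^ (-k) else 0) =
      ∑' v : Fin 2 → ℤ, (gammaSet N 1 a).indicator G v :=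
    tsum_subtype (gammaSet N 1 a) G
  rw [h1]
  have hne : (![0, 1] : Fin 2 → ℤ) ≠ ![0, -1] := by
    intro h
    have := congr_fun h 1
    simp at this
  have hsupp : ∀ v ∉ ({![0, 1], ![0, -1]} : Finset (Fin 2 → ℤ)), (gammaSet N 1 a).indicator G v = 0 := by
    intro v hv
    by_cases hmem : v ∈ gammaSet N 1 a
    · rw [Set.indicator_of_mem hmem]
      simp only [hG]
      split_ifs with h0
      · exfalso
        have hg : (v 0).gcd (v 1) = 1 := hmem.2
        rw [h0, Int.gcd_zero_left] at hg
        apply hv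
        rw [Finset.mem_insert, Finset.mem_singleton]
        rcases Int.natAbs_eq_iff.mp hg with h | h
        · left
          funext i
          fin_cases i
          · exact h0
          · simpa using h
        · right
          funext i
          fin_cases i
          · exact h0
          · simpa using h
      · rfl
    · exact Set.indicator_of_notMem hmem _
  rw [tsum_eq_sum hsupp, Finset.sum_pair hne, eisCuspValue]
  congr 1
  · by_cases hmem : (![0, 1] : Fin 2 → ℤ) ∈ gammaSet N 1 a
    · rw [Set.indicator_of_mem hmem, if_pos hmem.1]
      simp [hG]
    · rw [Set.indicator_of_notMem hmem, if_neg]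
      exact fun h ↦ hmem ⟨h, by simp⟩
  · by_cases hmem : (![0, -1] : Fin 2 → ℤ) ∈ gammaSet N 1 a
    · rw [Set.indicator_of_mem hmem, if_pos hmem.1]
      simp [hG]
    · rw [Set.indicator_of_notMem hmem, if_neg]
      exact fun h ↦ hmem ⟨h, by simp⟩

/-- **The value of the Eisenstein series `E_{k,a}` of level `Γ(N)` at `i∞`** (`k ≥ 3`):
`E_{k,a}(τ) → [a ≡ (0,1)] + [a ≡ (0,-1)](-1)^{-k}` as `im τ → ∞`. Every `τ` is translated by a
power of `T^N ∈ Γ(N)` into the strip `|re τ| ≤ N` (Mathlib `ModularGroup_T_zpow_mem_verticalStrip`,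
`T_zpow_width_invariant`), where `tendsto_eisensteinSeries_inf_principal` applies.
[cite: DiamondShurman2005, §4.2 (Thm. 4.2.3)] -/
theorem tendsto_eisensteinSeries_atImInfty (hk : 3 ≤ k) (a : Fin 2 → ZMod N) :
    Tendsto (eisensteinSeries a k) atImInfty (𝓝 (eisCuspValue a k)) := by
  have hlim := tendsto_eisensteinSeries_inf_principal hk a
  rw [tsum_gammaSet_fst_eq_zero] at hlim
  choose n hn using fun z : ℍ ↦ ModularGroup_T_zpow_mem_verticalStrip z (NeZero.pos N)
  set s : ℍ → ℍ := fun z ↦ ModularGroup.T ^ ((N : ℤ) * n z) • z with hs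
  have hinv : ∀ z, eisensteinSeries a k (s z) = eisensteinSeries a k z := fun z ↦
    SlashInvariantForm.T_zpow_width_invariant N k (n z) (eisensteinSeriesSIF a k) z
  have hs𝓕 : Tendsto s atImInfty (atImInfty ⊓ 𝓟 {z : ℍ | |z.re| ≤ N}) := by
    refine tendsto_inf.2 ⟨?_, tendsto_principal.2 (Eventually.of_forall fun z ↦ (hn z).1)⟩
    rw [atImInfty, tendsto_comap_iff]
    exact tendsto_atTop_mono (fun z ↦ (hn z).2) tendsto_comap
  have hcomp := hlim.comp hs𝓕
  have heq : eisensteinSeries a k ∘ s = eisensteinSeries a k := funext hinv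
  rwa [heq] at hcomp

end CuspValue

/-! ### The character sums `E_k^χ` -/

section Character

variable (N : ℕ) [NeZero N] (k : ℤ) (χ : DirichletCharacter ℂ N)

/-- **The Eisenstein series of weight `k` and nebentypus `χ` on `Γ₀(N)` (at the cusp `∞`)**, as a
function on `ℍ`: `E_k^χ = ∑_{u ∈ (ℤ/Nℤ)ˣ} χ(u)⁻¹ E_{k,(0,u)}` with Mathlib's level-`Γ(N)` series
`E_{k,(0,u)} = ∑_{(c,d) ≡ (0,u), gcd = 1} (cτ+d)^{-k}`. [cite: DiamondShurman2005, §4.5–4.6] -/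
def eisensteinChar : ℍ → ℂ :=
  fun z ↦ ∑ u : (ZMod N)ˣ, χ ((u⁻¹ : (ZMod N)ˣ) : ZMod N) * eisensteinSeries ![0, (u : ZMod N)] k z

variable {N k χ}

/-- `E_k^χ` as a sum of functions. [folklore] -/
theorem eisensteinChar_eq_sum : eisensteinChar N k χ =
    ∑ u : (ZMod N)ˣ, χ ((u⁻¹ : (ZMod N)ˣ) : ZMod N) • eisensteinSeries ![0, (u : ZMod N)] k := by
  funext z
  simp [eisensteinChar, Finset.sum_apply]

omit [NeZero N] in
/-- **`(0, u)γ ≡ (0, u d)` for `γ = (a b; c d) ∈ Γ₀(N)`** (as vectors over `ℤ/Nℤ`). [folklore] -/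
theorem vecMul_gamma0 {γ : SL(2, ℤ)} (hγ : γ ∈ Gamma0 N) (u : ZMod N) :
    (![0, u] : Fin 2 → ZMod N) ᵥ* γ = ![0, u * ((γ 1 1 : ℤ) : ZMod N)] := by
  rw [Gamma0_mem] at hγ
  funext j
  fin_cases j
  · simp [Matrix.vecMul, dotProduct, Fin.sum_univ_two, hγ]
  · simp [Matrix.vecMul, dotProduct, Fin.sum_univ_two]

omit [NeZero N] in
/-- `E_{k,(0,u)} ∣_k γ = E_{k,(0,ud)}` for `γ ∈ Γ₀(N)`. [folklore] -/
theorem eisensteinSeries_vecMul_gamma0 {γ : SL(2, ℤ)} (hγ : γ ∈ Gamma0 N) (u : ZMod N) :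
    eisensteinSeries (![0, u] : Fin 2 → ZMod N) k ∣[k] γ =
      eisensteinSeries ![0, u * ((γ 1 1 : ℤ) : ZMod N)] k := by
  rw [eisensteinSeries_slash_apply, vecMul_gamma0 hγ]

/-- The lower-right entry of `γ ∈ Γ₀(N)` is a unit modulo `N` (`ad - bc = 1`, `c ≡ 0`). [folklore] -/
theorem isUnit_gamma0_apply_one_one {γ : SL(2, ℤ)} (hγ : γ ∈ Gamma0 N) :
    IsUnit (((γ 1 1 : ℤ) : ZMod N)) := by
  have hdet := Matrix.SpecialLinearGroup.det_coe γ
  rw [Matrix.det_fin_two] at hdet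
  rw [Gamma0_mem] at hγ
  have h : ((γ 0 0 : ℤ) : ZMod N) * ((γ 1 1 : ℤ) : ZMod N) = 1 := by
    have := congrArg ((↑) : ℤ → ZMod N) hdet
    push_cast at this
    rw [hγ, mul_zero, sub_zero] at this
    exact this
  exact IsUnit.of_mul_eq_one_right _ h

/-- **The nebentypus law**: `E_k^χ ∣_k γ = χ(d) E_k^χ` for `γ = (a b; c d) ∈ Γ₀(N)` — `E_k^χ` is
of type `(k, χ)` (reindex `u ↦ ud` in the character sum). [cite: DiamondShurman2005, §4.5–4.6 (Thm. 4.5.1, Thm. 4.6.2)] -/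
theorem eisensteinChar_slash_of_mem_gamma0 {γ : SL(2, ℤ)} (hγ : γ ∈ Gamma0 N) :
    eisensteinChar N k χ ∣[k] γ = χ ((γ 1 1 : ℤ) : ZMod N) • eisensteinChar N k χ := by
  obtain ⟨d, hd⟩ := isUnit_gamma0_apply_one_one hγ
  rw [eisensteinChar_eq_sum, SlashAction.sum_slash, Finset.smul_sum]
  simp_rw [ModularForm.SL_smul_slash, eisensteinSeries_vecMul_gamma0 hγ, ← hd]
  -- reindex by `u ↦ u d`
  refine Fintype.sum_equiv (Equiv.mulRight d) _ _ fun u ↦ ?_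
  simp only [Equiv.coe_mulRight, Units.val_mul, smul_smul]
  congr 1
  rw [← map_mul, _root_.mul_inv_rev, Units.val_mul, ← mul_assoc, Units.mul_inv, one_mul]

/-- **The value of `E_k^χ` at `i∞`**: `E_k^χ(τ) → 1 + χ(-1)(-1)^k` (the units `u = 1` and
`u = -1` pick up the two surviving terms of `tendsto_eisensteinSeries_atImInfty`).
[cite: DiamondShurman2005, §4.2, §4.5] -/
theorem tendsto_eisensteinChar_atImInfty (hk : 3 ≤ k) :
    Tendsto (eisensteinChar N k χ) atImInfty (𝓝 (1 + χ (-1) * (-1) ^ k)) := by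
  classical
  have hlim : Tendsto (eisensteinChar N k χ) atImInfty
      (𝓝 (∑ u : (ZMod N)ˣ, χ ((u⁻¹ : (ZMod N)ˣ) : ZMod N) * eisCuspValue ![0, (u : ZMod N)] k)) :=
    tendsto_finsetSum _ fun u _ ↦ (tendsto_eisensteinSeries_atImInfty hk _).const_mul _
  convert hlim using 2
  have h1 : ∀ u : (ZMod N)ˣ, (((↑) : ℤ → ZMod N) ∘ ![0, 1] = ![0, (u : ZMod N)]) ↔ u = 1 := by
    intro u
    constructor
    · intro h
      have := congr_fun h 1
      simp only [Function.comp_apply, Matrix.cons_val_one, Matrix.cons_val_fin_one,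
        Int.cast_one] at this
      exact Units.ext this.symm
    · rintro rfl
      funext i
      fin_cases i <;> simp
  have h2 : ∀ u : (ZMod N)ˣ, (((↑) : ℤ → ZMod N) ∘ ![0, -1] = ![0, (u : ZMod N)]) ↔ u = -1 := by
    intro u
    constructor
    · intro h
      have := congr_fun h 1
      simp only [Function.comp_apply, Matrix.cons_val_one, Matrix.cons_val_fin_one,
        Int.cast_neg, Int.cast_one] at this
      exact Units.ext (by simpa using this.symm)
    · rintro rfl
      funext i
      fin_cases i <;> simp
  simp only [eisCuspValue, h1, h2, mul_add, mul_ite, mul_one, mul_zero, Finset.sum_add_distrib,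
    Finset.sum_ite_eq', Finset.mem_univ, if_true, inv_one, Units.val_one, map_one, inv_neg,
    Units.val_neg]
  congr 1
  rw [zpow_neg, ← inv_zpow, inv_neg, inv_one]

/-- **`E_k^χ ≢ 0` when `χ(-1) = (-1)^k`**: its value at `i∞` is `2`. [cite: DiamondShurman2005, §4.5–4.6] -/
theorem eisensteinChar_ne_zero (hk : 3 ≤ k) (hχ : χ (-1) = (-1) ^ k) :
    eisensteinChar N k χ ≠ 0 := by
  intro h0
  have hlim := tendsto_eisensteinChar_atImInfty (N := N) (χ := χ) hk
  rw [hχ, ← zpow_add₀ (by norm_num : (-1 : ℂ) ≠ 0), h0] at hlim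
  have h2 : (-1 : ℂ) ^ (k + k) = 1 := by
    rw [← two_mul, zpow_mul]
    norm_num
  rw [h2] at hlim
  have := tendsto_nhds_unique (tendsto_const_nhds (x := (0 : ℂ))) hlim
  norm_num at this

/-! ### `E_k^χ` as a modular form on `Γ₁(N)` -/

/-- Holomorphy of `E_k^χ` (`k ≥ 3`). [folklore] -/
theorem mdifferentiable_eisensteinChar (hk : 3 ≤ k) :
    MDifferentiable 𝓘(ℂ) 𝓘(ℂ) (eisensteinChar N k χ) := by
  rw [eisensteinChar_eq_sum]
  have : ∀ s : Finset (ZMod N)ˣ, MDifferentiable 𝓘(ℂ) 𝓘(ℂ) (∑ u ∈ s,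
      χ ((u⁻¹ : (ZMod N)ˣ) : ZMod N) • eisensteinSeries ![0, (u : ZMod N)] k) := by
    intro s
    induction s using Finset.induction_on with
    | empty =>
      simp only [Finset.sum_empty]
      exact mdifferentiable_const
    | insert u s hu ih =>
      rw [Finset.sum_insert hu]
      exact ((eisensteinSeriesSIF_mdifferentiable hk _).const_smul _).add ih
  exact this _

/-- Every `SL₂(ℤ)`-translate of `E_k^χ` is bounded at `i∞` (`k ≥ 3`). [folklore] -/
theorem isBoundedAtImInfty_eisensteinChar_slash (hk : 3 ≤ k) (g : SL(2, ℤ)) :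
    IsBoundedAtImInfty (eisensteinChar N k χ ∣[k] g) := by
  rw [eisensteinChar_eq_sum, SlashAction.sum_slash]
  have : ∀ s : Finset (ZMod N)ˣ, IsBoundedAtImInfty (∑ u ∈ s,
      (χ ((u⁻¹ : (ZMod N)ˣ) : ZMod N) • eisensteinSeries ![0, (u : ZMod N)] k) ∣[k] g) := by
    intro s
    induction s using Finset.induction_on with
    | empty =>
      simp only [Finset.sum_empty]
      exact zero_form_isBoundedAtImInfty
    | insert u s hu ih =>
      rw [Finset.sum_insert hu, ModularForm.SL_smul_slash]
      exact ((isBoundedAtImInfty_eisensteinSeriesSIF _ hk g).const_smul_left _).add ih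
  exact this _

/-- `E_k^χ` is invariant under `Γ₁(N)` (the nebentypus law with `d ≡ 1`). [folklore] -/
theorem eisensteinChar_slash_of_mem_gamma1 {γ : SL(2, ℤ)} (hγ : γ ∈ Gamma1 N) :
    eisensteinChar N k χ ∣[k] γ = eisensteinChar N k χ := by
  rw [Gamma1_mem] at hγ
  rw [eisensteinChar_slash_of_mem_gamma0 (Gamma0_mem.2 hγ.2.2), hγ.2.1, map_one, one_smul]

variable (N k χ) in
/-- **`E_k^χ` as a modular form of weight `k ≥ 3` on `Γ₁(N)`** (holomorphic, `Γ₁(N)`-invariant,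
bounded at every cusp). [cite: DiamondShurman2005, §4.5–4.6 (Thm. 4.5.1, Thm. 4.6.2)] -/
def eisensteinCharMF (hk : 3 ≤ k) : ModularForm (Gamma1 N) k where
  toFun := eisensteinChar N k χ
  slash_action_eq' A hA := by
    obtain ⟨A, (hA : A ∈ Gamma1 N), rfl⟩ := hA
    exact eisensteinChar_slash_of_mem_gamma1 hA
  holo' := mdifferentiable_eisensteinChar hk
  bdd_at_cusps' {c} hc := by
    rw [Subgroup.IsArithmetic.isCusp_iff_isCusp_SL2Z] at hc
    rw [OnePoint.isBoundedAt_iff_forall_SL2Z hc]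
    intro γ _
    exact isBoundedAtImInfty_eisensteinChar_slash hk γ

/-- The function of `eisensteinCharMF` is `eisensteinChar`. [folklore] -/
@[simp] theorem coe_eisensteinCharMF (hk : 3 ≤ k) :
    (⇑(eisensteinCharMF N k χ hk) : ℍ → ℂ) = eisensteinChar N k χ := rfl

/-- **Nebentypus law for the modular form `E_k^χ`**: `E_k^χ ∣_k γ = χ(d) E_k^χ` on `Γ₀(N)`. [cite: DiamondShurman2005, Thm. 4.6.2] -/
theorem eisensteinCharMF_slash_of_mem_gamma0 (hk : 3 ≤ k) (γ : SL(2, ℤ)) (hγ : γ ∈ Gamma0 N) :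
    (⇑(eisensteinCharMF N k χ hk) : ℍ → ℂ) ∣[k] γ =
      χ ((γ 1 1 : ℤ) : ZMod N) • (⇑(eisensteinCharMF N k χ hk) : ℍ → ℂ) :=
  eisensteinChar_slash_of_mem_gamma0 hγ

/-- **`E_k^χ ≠ 0` in `M_k(Γ₁(N))` when `χ(-1) = (-1)^k`.** [cite: DiamondShurman2005, §4.5–4.6] -/
theorem eisensteinCharMF_ne_zero (hk : 3 ≤ k) (hχ : χ (-1) = (-1) ^ k) :
    eisensteinCharMF N k χ hk ≠ 0 := by
  intro h
  apply eisensteinChar_ne_zero (N := N) (χ := χ) hk hχ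
  have := congrArg (fun F : ModularForm (Gamma1 N) k ↦ (⇑F : ℍ → ℂ)) h
  simpa using this

/-- **The value of the modular form `E_k^χ` at `i∞` is `1 + χ(-1)(-1)^k`** (`= 2` in the matching
parity). [cite: DiamondShurman2005, §4.2, §4.5] -/
theorem tendsto_eisensteinCharMF_atImInfty (hk : 3 ≤ k) :
    Tendsto (⇑(eisensteinCharMF N k χ hk)) atImInfty (𝓝 (1 + χ (-1) * (-1) ^ k)) :=
  tendsto_eisensteinChar_atImInfty hk

end Character

/-! ### Functions of distinct nebentypus are linearly independent -/

section Nebentypus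

variable {N : ℕ} [NeZero N] {k : ℤ}

/-- **Every unit of `ℤ/Nℤ` is the lower-right entry of a matrix of `Γ₀(N)`** (surjectivity of
`Γ₀(N) → (ℤ/Nℤ)ˣ`, `(a b; c d) ↦ d`; Bézout: `(A -B; N m) ∈ Γ₀(N)` with `Am + BN = 1`). Reproved
here (it is `exists_gamma0Map_eq_holds` of `HeckeOperators`) to keep the imports of this file
light. [cite: DiamondShurman2005, §5.2, p. 168] -/
theorem exists_mem_gamma0_apply_one_one_eq (d : (ZMod N)ˣ) :
    ∃ γ : SL(2, ℤ), γ ∈ Gamma0 N ∧ ((γ 1 1 : ℤ) : ZMod N) = d := by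
  set m : ℕ := (d : ZMod N).val with hm_def
  have hmd : (m : ZMod N) = d := ZMod.natCast_zmod_val _
  have hm : m.Coprime N := by
    rw [← ZMod.isUnit_iff_coprime, hmd]
    exact d.isUnit
  have hbez : (m : ℤ) * Nat.gcdA m N + (N : ℤ) * Nat.gcdB m N = 1 := by
    rw [← Nat.gcd_eq_gcd_ab, hm.gcd_eq_one, Nat.cast_one]
  let A : Matrix (Fin 2) (Fin 2) ℤ := !![Nat.gcdA m N, -Nat.gcdB m N; N, m]
  have hdet : A.det = 1 := by
    rw [Matrix.det_fin_two_of]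
    linear_combination hbez
  refine ⟨⟨A, hdet⟩, by simp [Gamma0_mem, A], ?_⟩
  simp [A, hmd]

/-- Twisting a vanishing sum of functions of nebentypus `χ` by `γ_d ∈ Γ₀(N)`:
`∑_χ χ(d) f_χ = 0` for every `d` (trivially for non-units). [folklore] -/
theorem sum_apply_smul_eq_zero_of_sum_eq_zero (s : Finset (DirichletCharacter ℂ N))
    (f : DirichletCharacter ℂ N → ℍ → ℂ)
    (hf : ∀ χ ∈ s, ∀ γ : SL(2, ℤ), γ ∈ Gamma0 N → f χ ∣[k] γ = χ ((γ 1 1 : ℤ) : ZMod N) • f χ)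
    (h0 : ∑ χ ∈ s, f χ = 0) (d : ZMod N) : ∑ χ ∈ s, χ d • f χ = 0 := by
  by_cases hd : IsUnit d
  · obtain ⟨γ, hγ, hγd⟩ := exists_mem_gamma0_apply_one_one_eq (N := N) hd.unit
    have h := congrArg (fun g : ℍ → ℂ ↦ g ∣[k] γ) h0
    simp only [SlashAction.sum_slash, SlashAction.zero_slash] at h
    rw [← h]
    refine Finset.sum_congr rfl fun χ hχ ↦ ?_
    rw [hf χ hχ γ hγ, hγd, IsUnit.unit_spec]
  · exact Finset.sum_eq_zero fun χ _ ↦ by rw [MulChar.map_nonunit χ hd, zero_smul]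

/-- **Functions of pairwise distinct nebentypus on `Γ₀(N)` are linearly independent**: if
`f_χ ∣_k γ = χ(d) f_χ` for all `γ ∈ Γ₀(N)` and `∑_χ f_χ = 0`, then every `f_χ = 0` (twist by
`γ_d`, multiply by `χ₀(d)⁻¹` and sum over `d`: orthogonality of characters). This is the
decomposition `M_k(Γ₁(N)) = ⊕_χ M_k(Γ₀(N), χ)` at the level of functions.
[cite: DiamondShurman2005, §4.3 (p. 119, the decomposition by characters)] -/
theorem eq_zero_of_sum_nebentypus_eq_zero (s : Finset (DirichletCharacter ℂ N))
    (f : DirichletCharacter ℂ N → ℍ → ℂ)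
    (hf : ∀ χ ∈ s, ∀ γ : SL(2, ℤ), γ ∈ Gamma0 N → f χ ∣[k] γ = χ ((γ 1 1 : ℤ) : ZMod N) • f χ)
    (h0 : ∑ χ ∈ s, f χ = 0) : ∀ χ ∈ s, f χ = 0 := by
  classical
  intro χ₀ hχ₀
  have hrel := sum_apply_smul_eq_zero_of_sum_eq_zero s f hf h0
  have hsum : ∑ d : ZMod N, χ₀⁻¹ d • ∑ χ ∈ s, χ d • f χ = 0 := by
    simp [hrel]
  have hswap : ∑ d : ZMod N, χ₀⁻¹ d • ∑ χ ∈ s, χ d • f χ =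
      ∑ χ ∈ s, (∑ d : ZMod N, (χ₀⁻¹ * χ) d) • f χ := by
    simp_rw [Finset.smul_sum, smul_smul, ← MulChar.mul_apply]
    rw [Finset.sum_comm]
    simp_rw [← Finset.sum_smul]
  rw [hswap, Finset.sum_eq_single χ₀ ?_ (fun h ↦ absurd hχ₀ h)] at hsum
  · rw [inv_mul_cancel, MulChar.sum_one_eq_card_units] at hsum
    have hcard : ((Fintype.card (ZMod N)ˣ : ℕ) : ℂ) ≠ 0 := by
      exact_mod_cast Fintype.card_ne_zero
    exact (smul_eq_zero.mp hsum).resolve_left hcard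
  · intro χ _ hne
    rw [MulChar.sum_eq_zero_of_ne_one, zero_smul]
    intro h1
    apply hne
    calc χ = χ₀ * (χ₀⁻¹ * χ) := by rw [← mul_assoc, mul_inv_cancel, one_mul]
      _ = χ₀ := by rw [h1, mul_one]

end Nebentypus

end Literature.NumberTheory.EllipticCurves.ModularForms
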